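import Summits.BirchSwinnertonDyer.BirchSwinnertonDyer.Theorems.KatoDescentPotSupersingularZetaBodyRankOneDecoupling
import HarnessLib

/-!
# Tightness lemma for the rank-ONE residual (K9 `WildRankOne` 19200 / KT `TameRankOne` 19984), PART 19:
# GROUP-RING REFITS of the tree's Kato zeta data — the functionals of `Kato2004.ZetaBody` can absorb
# the action of `θ = σ̃ + c ∈ ℤ_p[Gal(ℚ̄/ℚ)]` on the classes, level by level; at the bottom level `θ`
# is the scalar `1 + c`, on a `χ`-eigenclass of `σ̃` it is the scalar `χ(σ̃) + c`

Cell `bsd-potss` (FULL-BSD rank ≤ 1, tranche 1b), seat `bsd-potss-kmc` (descent from Kato's Λ-adic main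
conjecture), generation 12, part 19; memo HOME/bsd-potss-kmc/KMC-DESCENT-MEMO-v11.md, finding F6.
ROUTE-FREE (no route import); `--supports stmt-BirchSwinnertonDyer-19200`.  Proofs only (no definition:
the refit operator `θ•y := σ̃•y + c•y` and the refit functional
`Λ^θ(y) := (1 − (−c)^n)⁻¹ • Σ_{i<n} (−c)^i • Λ(σ̃^{n−1−i}•y)` enter through defining hypotheses `hz'`, `hΛ'`;
`exists_refit_functional` shows the latter IS a `ℤ_p`-linear map).

WHAT THIS SHOWS.  PART 17c/18 (`zetaBody_smul`, `zetaBody_rescale`) exhibited the SCALAR symmetries of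
`ZetaBody W p f ι κ Λ c d a A z x`; memo v10 §3 proposed to pin the scale of the classes at ONE tame level
with a non-vanishing value («twist-pin» at a quadratic `χ_D`, existential image exponent).  Here: a
NON-SCALAR symmetry such a pin does not see.  For `σ̃ ∈ Γ_ℚ`, `c ∈ ℤ_p` let `θ = σ̃ + c` act on
`H¹(ℚ(μ_m), T_pW)` through the `Gal(ℚ(μ_m)/ℚ)`-action `conjMap`.  As `σ̃^n` acts trivially for
`n = [Γ_ℚ : Gal(ℚ̄/ℚ(μ_m))]` (`conjMap_one_apply_of_mem`), `θ` is invertible over `ℚ_p` at every level once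
`(−c)^n ≠ 1` (telescoping, `sum_conj_refit`), and `Λ^θ := Λ ∘ θ⁻¹` (`ZetaBody` asks no integrality of
`Λ`) is again equivariant (C3a) (the levels are abelian, `commutator_le_level`) and local (C3b) granted
that local triviality above `p` is `Gal`-stable, with `Λ^θ(θ•y) = Λ(y)` (`refit_functional_refit`).  Hence
`zetaBody_refit`: `(κ, Λ, z, x) ↦ (κ, Λ^θ, θ•z, x)` preserves `ZetaBody` — SAME constant, SAME values —
granted the displayed transport hypotheses `hES`/`hur`/`hloc` (Rubin: `ES(T)` is a `ℤ_p[G_ℚ]`-module;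
naturality of restriction/corestriction under conjugation — standard, not in the tree).  WHAT A PIN SEES
(`refit_bottom`, `smul_refit_functional_of_eigen`): the bottom class becomes `(1 + c)•z_ℚ`; on a class
with `σ̃•y = ε•y` the functional becomes `(ε + c)⁻¹•Λ`, so a single-component pin with an existential
image exponent `a` is carried along with `a ↦ a − v_p(χ(σ̃) + c)` while `pos(z_ℚ)` moves by
`v_p(1 + c)`: for `c = p − 1`, `χ_D(σ̃) = −1`, `p` odd, `1 ≠ 0`.  So the node of memo v10 §3 is NOT
invariant (memo v11 F6); characters of order prime to `p` never separate the trivial component; only a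
character `χ ≡ 𝟙 (mod 𝔭)` with an EXPLICIT exponent does (memo v11 F7).  Nothing about BSD is asserted.

References: Rubin, *Euler Systems* (2000), Def. 2.1.1, Ch. II §4; PCMI lectures (2009) §4.1 ("the
`ℤ_p[G_ℚ]`-module of Euler systems") [Rubin2000]; Serre, *Local Fields*, GTM 67 (1979), VII §5 Prop. 3
[Serre1979]; Kato, Astérisque 295 (2004) §9.4, Thm. 9.7, Thm. 6.6 (1) [Kato2004Asterisque]; Burns–Kurihara–
Sano, arXiv:1910.07404, Hyp. 2.2 / Rem. 2.3 [BurnsKuriharaSano2019]; tree `GaloisRepresentations/EulerSystem.lean`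
(`conjMap_*`, `commutator_le_level`), `Kato2004/EulerSystemValues.lean` (`ZetaBody`).
-/

set_option autoImplicit false
set_option linter.dupNamespace false

noncomputable section

open scoped NumberField TensorProduct Pointwise
open Field IsDedekindDomain CongruenceSubgroup
open Literature.NumberTheory.GaloisRepresentations
open Literature.NumberTheory.EllipticCurves Literature.NumberTheory.EllipticCurves.ModularForms
open Literature.NumberTheory.EllipticCurves.Kato2004
open Literature.NumberTheory.EllipticCurves.Kato2004.EulerSystemValues Rat.HeightOneSpectrum

namespace Summit.BirchSwinnertonDyer.BirchSwinnertonDyer.Theorems.ZetaBodyRefit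

/-! ## §1 The `Gal`-action on `H¹(U, T_pW)` and the refit `θ•y = σ̃•y + c•y` -/

section Operators

variable {W : WeierstrassCurve ℚ} [W.IsElliptic] {p : ℕ} [Fact p.Prime]
  [ContinuousSMul ℤ_[p] (W.tateModule p)]
  (U : Subgroup (absoluteGaloisGroup ℚ)) [U.Normal]

/-- `(στ)•y = σ•(τ•y)` on `H¹(U, T_pW)`. [cite: Serre1979, VII §5] -/
theorem conj_mul (σ τ : absoluteGaloisGroup ℚ) (y : H1 (tateRep W p) U) :
    conjMap (tateRep W p).toTopRep U (σ * τ) 1 y =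
      conjMap (tateRep W p).toTopRep U σ 1 (conjMap (tateRep W p).toTopRep U τ 1 y) :=
  conjMap_mul_apply_one (tateRep W p).toTopRep U σ τ y

/-- Elements of `U` act trivially on `H¹(U, T_pW)`. [cite: Serre1979, VII §5 Prop. 3] -/
theorem conj_eq_self_of_mem {σ : absoluteGaloisGroup ℚ} (hσ : σ ∈ U) (y : H1 (tateRep W p) U) :
    conjMap (tateRep W p).toTopRep U σ 1 y = y :=
  conjMap_one_apply_of_mem (tateRep W p).toTopRep U ⟨σ, hσ⟩ y

/-- Powers: `σ̃^j` acts by the `j`-th power of the operator of `σ̃`. [cite: Serre1979, VII §5] -/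
theorem conj_pow (σ : absoluteGaloisGroup ℚ) (j : ℕ) :
    (conjMap (tateRep W p).toTopRep U (σ ^ j) 1).hom.toLinearMap =
      (conjMap (tateRep W p).toTopRep U σ 1).hom.toLinearMap ^ j := by
  induction j with
  | zero =>
    refine LinearMap.ext fun y ↦ ?_
    rw [pow_zero, pow_zero, Module.End.one_apply]
    exact conj_eq_self_of_mem U U.one_mem y
  | succ j ih =>
    refine LinearMap.ext fun y ↦ ?_
    rw [pow_succ, pow_succ, Module.End.mul_apply, ← ih]
    exact conj_mul U _ _ y

open scoped commutatorElement in
/-- On an abelian level (`[Γ_ℚ, Γ_ℚ] ≤ U`, e.g. every cyclotomic level) the operators commute.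
[cite: Serre1979, VII §5 Prop. 3] -/
theorem conj_comm (hU : commutator (absoluteGaloisGroup ℚ) ≤ U) (σ τ : absoluteGaloisGroup ℚ)
    (y : H1 (tateRep W p) U) :
    conjMap (tateRep W p).toTopRep U σ 1 (conjMap (tateRep W p).toTopRep U τ 1 y) =
      conjMap (tateRep W p).toTopRep U τ 1 (conjMap (tateRep W p).toTopRep U σ 1 y) := by
  rw [← conj_mul, ← conj_mul]
  refine conjMap_apply_one_eq_of_inv_mul_mem (tateRep W p).toTopRep U (hU ?_) y
  have e : (τ * σ)⁻¹ * (σ * τ) = ⁅σ⁻¹, τ⁻¹⁆ := by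
    rw [commutatorElement_def]
    group
  rw [e, commutator_def]
  exact Subgroup.commutator_mem_commutator (Subgroup.mem_top _) (Subgroup.mem_top _)

/-- **At a level containing `σ̃` the refit is the SCALAR `1 + c`:** `σ̃•y + c•y = (1 + c)•y` (in
particular at the bottom level `U = Gal(ℚ̄/ℚ(μ_1)) = Γ_ℚ`). [cite: Serre1979, VII §5 Prop. 3] -/
theorem refit_eq_smul_of_mem {σ : absoluteGaloisGroup ℚ} (hσ : σ ∈ U) (c : ℤ_[p])
    (y : H1 (tateRep W p) U) : conjMap (tateRep W p).toTopRep U σ 1 y + c • y = (1 + c) • y := by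
  rw [conj_eq_self_of_mem U hσ, add_smul, one_smul]

/-- **On an eigenclass the refit is the scalar `ε + c`:** `σ̃•y = ε•y ⟹ σ̃•y + c•y = (ε + c)•y`
(e.g. `y` `χ`-isotypic, `ε = χ(σ̃)`). [cite: Rubin2000, Ch. II §4] -/
theorem refit_eq_smul_of_eigen {σ : absoluteGaloisGroup ℚ} {y : H1 (tateRep W p) U} {ε : ℤ_[p]}
    (hy : conjMap (tateRep W p).toTopRep U σ 1 y = ε • y) (c : ℤ_[p]) :
    conjMap (tateRep W p).toTopRep U σ 1 y + c • y = (ε + c) • y := by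
  rw [hy, add_smul]

/-- Telescoping: `Σ_{i<n} (−c)^i • A^{n−1−i}(A y + c•y) = A^n y − (−c)^n • y`. [folklore] -/
theorem sum_pow_apply_add_smul {R M : Type*} [CommRing R] [AddCommGroup M] [Module R M]
    (A : M →ₗ[R] M) (c : R) (y : M) (n : ℕ) :
    (∑ i ∈ Finset.range n, (-c) ^ i • (A ^ (n - 1 - i)) (A y + c • y)) = (A ^ n) y - (-c) ^ n • y := by
  induction n with
  | zero => simp
  | succ n ih =>
    rw [Finset.sum_range_succ]
    have hin : ∀ i ∈ Finset.range n,
        (-c) ^ i • (A ^ (n + 1 - 1 - i)) (A y + c • y) = A ((-c) ^ i • (A ^ (n - 1 - i)) (A y + c • y)) := by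
      intro i hi
      have hi' : i < n := Finset.mem_range.mp hi
      have e : n + 1 - 1 - i = (n - 1 - i) + 1 := by omega
      rw [e, pow_succ', Module.End.mul_apply, map_smul]
    rw [Finset.sum_congr rfl hin, ← map_sum, ih]
    have e2 : n + 1 - 1 - n = 0 := by omega
    rw [e2, pow_zero, Module.End.one_apply, map_sub, map_smul,
      show A ^ (n + 1) = A * A ^ n from pow_succ' A n, Module.End.mul_apply,
      show (-c) ^ (n + 1) = (-c) ^ n * (-c) from pow_succ _ _, smul_add, smul_smul]
    module

/-- **Telescoping for `θ = σ̃ + c`:** if `σ̃^n ∈ U` then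
`Σ_{i<n} (−c)^i • σ̃^{n−1−i}•(σ̃•y + c•y) = (1 − (−c)^n) • y` — so `θ` is invertible over `ℚ_p` when
`(−c)^n ≠ 1`. [cite: Rubin2000, Ch. II §4] -/
theorem sum_conj_refit {σ : absoluteGaloisGroup ℚ} {n : ℕ} (hn : σ ^ n ∈ U) (c : ℤ_[p])
    (y : H1 (tateRep W p) U) :
    (∑ i ∈ Finset.range n, (-c) ^ i • conjMap (tateRep W p).toTopRep U (σ ^ (n - 1 - i)) 1
        (conjMap (tateRep W p).toTopRep U σ 1 y + c • y)) = (1 - (-c) ^ n) • y := by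
  have h := sum_pow_apply_add_smul (conjMap (tateRep W p).toTopRep U σ 1).hom.toLinearMap c y n
  simp only [← conj_pow] at h
  change (∑ i ∈ Finset.range n, (-c) ^ i • conjMap (tateRep W p).toTopRep U (σ ^ (n - 1 - i)) 1
      (conjMap (tateRep W p).toTopRep U σ 1 y + c • y)) =
    conjMap (tateRep W p).toTopRep U (σ ^ n) 1 y - (-c) ^ n • y at h
  rw [h, conj_eq_self_of_mem U hn, sub_smul, one_smul]

end Operators

/-! ## §2 The refit functional `Λ^θ = Λ ∘ θ⁻¹` at one level -/

section Functional

variable {W : WeierstrassCurve ℚ} [W.IsElliptic] {p : ℕ} [Fact p.Prime]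
  [ContinuousSMul ℤ_[p] (W.tateModule p)]
  (U : Subgroup (absoluteGaloisGroup ℚ)) [U.Normal] {m : ℕ}
  (Λ Λ' : H1 (tateRep W p) U →ₗ[ℤ_[p]] ℚ_[p] ⊗[ℚ] CyclotomicField m ℚ)
  (σ : absoluteGaloisGroup ℚ) (c : ℤ_[p]) (n : ℕ)

/-- `ℤ_p`-scalars act on `ℚ_p ⊗_ℚ ℚ(ζ_m)` through `ℚ_p`. [folklore] -/
theorem padicInt_smul_eq (s : ℤ_[p]) (v : ℚ_[p] ⊗[ℚ] CyclotomicField m ℚ) :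
    s • v = (s : ℚ_[p]) • v :=
  (algebraMap_smul ℚ_[p] s v).symm

/-- **The refit functional exists as a `ℤ_p`-linear map:**
`Λ^θ(y) = (1 − (−c)^n)⁻¹ • Σ_{i<n} (−c)^i • Λ(σ̃^{n−1−i}•y)` — a `ℚ_p`-combination of `ℤ_p`-linear maps
into the `ℚ_p`-space `ℚ_p ⊗ ℚ(ζ_m)` (`ZetaBody` asks no integrality of its value functionals).
[cite: Kato2004Asterisque, §9.4 (p. 188)] -/
theorem exists_refit_functional :
    ∃ Λθ : H1 (tateRep W p) U →ₗ[ℤ_[p]] ℚ_[p] ⊗[ℚ] CyclotomicField m ℚ, ∀ y,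
      Λθ y = ((1 : ℚ_[p]) - ((-c : ℤ_[p]) : ℚ_[p]) ^ n)⁻¹ •
        ∑ i ∈ Finset.range n, (-c) ^ i • Λ (conjMap (tateRep W p).toTopRep U (σ ^ (n - 1 - i)) 1 y) := by
  refine ⟨((1 : ℚ_[p]) - ((-c : ℤ_[p]) : ℚ_[p]) ^ n)⁻¹ • ∑ i ∈ Finset.range n,
    (-c) ^ i • (Λ ∘ₗ (conjMap (tateRep W p).toTopRep U (σ ^ (n - 1 - i)) 1).hom.toLinearMap), fun y ↦ ?_⟩
  simp only [LinearMap.smul_apply, LinearMap.coe_sum, Finset.sum_apply, LinearMap.comp_apply]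
  rfl

variable {Λ Λ' σ c n}
  (hΛ' : ∀ y, Λ' y = ((1 : ℚ_[p]) - ((-c : ℤ_[p]) : ℚ_[p]) ^ n)⁻¹ •
    ∑ i ∈ Finset.range n, (-c) ^ i • Λ (conjMap (tateRep W p).toTopRep U (σ ^ (n - 1 - i)) 1 y))
include hΛ'

/-- **`Λ^θ ∘ θ = Λ`:** for `σ̃^n ∈ U` and `(−c)^n ≠ 1` in `ℚ_p`, `Λ^θ(σ̃•y + c•y) = Λ(y)` — the refit
functional absorbs the refit of the classes ((C4) holds with the SAME value).
[cite: Kato2004Asterisque, Thm. 9.7 (p. 189)] [cite: Rubin2000, Ch. II §4] -/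
theorem refit_functional_refit (hn : σ ^ n ∈ U) (hc : (1 : ℚ_[p]) - ((-c : ℤ_[p]) : ℚ_[p]) ^ n ≠ 0)
    (y : H1 (tateRep W p) U) : Λ' (conjMap (tateRep W p).toTopRep U σ 1 y + c • y) = Λ y := by
  rw [hΛ']
  have hsum : (∑ i ∈ Finset.range n, (-c) ^ i • Λ (conjMap (tateRep W p).toTopRep U (σ ^ (n - 1 - i)) 1
        (conjMap (tateRep W p).toTopRep U σ 1 y + c • y))) =
      Λ (∑ i ∈ Finset.range n, (-c) ^ i • conjMap (tateRep W p).toTopRep U (σ ^ (n - 1 - i)) 1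
        (conjMap (tateRep W p).toTopRep U σ 1 y + c • y)) := by
    simp only [map_sum, map_smul]
  rw [hsum, sum_conj_refit U hn, map_smul, padicInt_smul_eq, smul_smul]
  have hcast : (((1 - (-c) ^ n : ℤ_[p])) : ℚ_[p]) = (1 : ℚ_[p]) - ((-c : ℤ_[p]) : ℚ_[p]) ^ n := by
    push_cast
    ring
  rw [hcast, inv_mul_cancel₀ hc, one_smul]

/-- **On an eigenclass the refit functional is `(ε + c)⁻¹ • Λ`:** `σ̃•y = ε•y ⟹ (ε + c) • Λ^θ(y) = Λ(y)`.
For `y` `χ`-isotypic (`ε = χ(σ̃)`): a pin of `Λ` on the `χ`-component (kernel, image lattice, value)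
becomes the same pin of `Λ^θ` with the image exponent shifted by `v_p(χ(σ̃) + c)`.
[cite: Rubin2000, Ch. II §4] [cite: BurnsKuriharaSano2019, Hyp. 2.2 and Remark 2.3] -/
theorem smul_refit_functional_of_eigen (hn : σ ^ n ∈ U)
    (hc : (1 : ℚ_[p]) - ((-c : ℤ_[p]) : ℚ_[p]) ^ n ≠ 0) {y : H1 (tateRep W p) U} {ε : ℤ_[p]}
    (hy : conjMap (tateRep W p).toTopRep U σ 1 y = ε • y) : (ε + c) • Λ' y = Λ y := by
  rw [← map_smul, ← refit_eq_smul_of_eigen U hy c, refit_functional_refit U hΛ' hn hc]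

/-- **(C3a) is transported:** if `Λ(τ•y) = A_τ(Λ y)` for an additive `ℚ_p`-homogeneous `A_τ` (in
`ZetaBody`: `A_τ = 1 ⊗ σ_{χ_m(τ)}`) and `Γ_ℚ/U` is abelian, then `Λ^θ(τ•y) = A_τ(Λ^θ y)`.
[cite: Kato2004Asterisque, §9.4 (p. 188)] [cite: Serre1979, VII §5] -/
theorem refit_functional_conj (hU : commutator (absoluteGaloisGroup ℚ) ≤ U) (τ : absoluteGaloisGroup ℚ)
    (Aτ : ℚ_[p] ⊗[ℚ] CyclotomicField m ℚ →+ ℚ_[p] ⊗[ℚ] CyclotomicField m ℚ)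
    (hA : ∀ (t : ℚ_[p]) (v : ℚ_[p] ⊗[ℚ] CyclotomicField m ℚ), Aτ (t • v) = t • Aτ v)
    (hΛ : ∀ y : H1 (tateRep W p) U, Λ (conjMap (tateRep W p).toTopRep U τ 1 y) = Aτ (Λ y))
    (y : H1 (tateRep W p) U) :
    Λ' (conjMap (tateRep W p).toTopRep U τ 1 y) = Aτ (Λ' y) := by
  rw [hΛ', hΛ', hA, map_sum]
  congr 1
  refine Finset.sum_congr rfl fun i _ ↦ ?_
  rw [← conj_comm U hU, hΛ, padicInt_smul_eq, padicInt_smul_eq, hA]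

/-- **(C3b) is transported:** if a property `P` of classes (in `ZetaBody`: "all restrictions to the
decomposition groups above `p` vanish") is `Gal`-stable and `Λ` kills the classes with `P`, so does `Λ^θ`.
[cite: Kato2004Asterisque, §9.4 (p. 188)] -/
theorem refit_functional_eq_zero_of (P : H1 (tateRep W p) U → Prop)
    (hP : ∀ (τ : absoluteGaloisGroup ℚ) (y : H1 (tateRep W p) U),
      P y → P (conjMap (tateRep W p).toTopRep U τ 1 y))
    (hΛ : ∀ y : H1 (tateRep W p) U, P y → Λ y = 0) {y : H1 (tateRep W p) U} (hy : P y) :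
    Λ' y = 0 := by
  rw [hΛ']
  have h0 : ∀ i ∈ Finset.range n,
      (-c) ^ i • Λ (conjMap (tateRep W p).toTopRep U (σ ^ (n - 1 - i)) 1 y) = 0 := by
    intro i _
    rw [hΛ _ (hP _ y hy), smul_zero]
  rw [Finset.sum_congr rfl h0, Finset.sum_const_zero, smul_zero]

end Functional

/-! ## §3 The refit of a `ZetaBody` datum; what a single-level pin sees -/

section ZetaBodyRefit

variable {W : WeierstrassCurve ℚ} [W.IsElliptic] {p : ℕ} [Fact p.Prime]
  [ContinuousSMul ℤ_[p] (W.tateModule p)] [Module.Free ℤ_[p] (W.tateModule p)]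
  [Module.Finite ℤ_[p] (W.tateModule p)] {N : ℕ} {f : CuspForm (Gamma0 N) 2}
  {ι : (m : ℕ) → (CyclotomicField m ℚ →+* ℂ)} {κ : ℝ}
  {Λ Λ' : ∀ (k : ℕ) (r : Finset (HeightOneSpectrum (𝓞 ℚ))),
    H1 (tateRep W p) (cycSubgroup p k r) →ₗ[ℤ_[p]] ℚ_[p] ⊗[ℚ] CyclotomicField (cycLevel p k r) ℚ}
  {c d a : ℤ} {A : ℕ}
  {z z' : ∀ (k : ℕ) (r : (cyclotomicLevelsRat p (badPlaces c d A N)).Ideals),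
    H1 (tateRep W p) (cycSubgroup p k r.1)}
  {x : ∀ (k : ℕ) (r : (cyclotomicLevelsRat p (badPlaces c d A N)).Ideals),
    CyclotomicField (cycLevel p k r.1) ℚ}
  {σ : absoluteGaloisGroup ℚ} {c₀ : ℤ_[p]}
  (hz' : ∀ (k : ℕ) (r : (cyclotomicLevelsRat p (badPlaces c d A N)).Ideals),
    z' k r = conjMap (tateRep W p).toTopRep (cycSubgroup p k r.1) σ 1 (z k r) + c₀ • z k r)
  (hΛ' : ∀ (k : ℕ) (r : Finset (HeightOneSpectrum (𝓞 ℚ))) (y : H1 (tateRep W p) (cycSubgroup p k r)),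
    Λ' k r y = ((1 : ℚ_[p]) - ((-c₀ : ℤ_[p]) : ℚ_[p]) ^ (cycSubgroup p k r).index)⁻¹ •
      ∑ i ∈ Finset.range (cycSubgroup p k r).index, (-c₀) ^ i •
        Λ k r (conjMap (tateRep W p).toTopRep (cycSubgroup p k r)
          (σ ^ ((cycSubgroup p k r).index - 1 - i)) 1 y))

include hz' hΛ'

/-- **GROUP-RING REFIT OF THE ZETA DATA (tightness, PART 19).**  Let `(κ, Λ, z, x)` satisfy
`ZetaBody W p f ι κ Λ c d a A z x`, `σ̃ ∈ Γ_ℚ`, `c₀ ∈ ℤ_p` with `(−c₀)^{n_{k,r}} ≠ 1` in `ℚ_p` at every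
level, `n_{k,r} = [Γ_ℚ : Gal(ℚ̄/ℚ(μ_m))]` (`c₀ = p − 1`: `one_sub_neg_pow_ne_zero`); let `z' = θ•z`
(`hz'`) and `Λ' = Λ^θ` (`hΛ'`).  GRANT the standard transport facts for the `Gal`-action on classes
(DISPLAYED hypotheses — the tree does not prove naturality of restriction / corestriction under
conjugation): `hES` (`θ•z` is an Euler system; Rubin: `ES(T)` is a `ℤ_p[G_ℚ]`-module), `hur` (`θ•z` is
unramified away from `p`), `hloc` (local triviality above `p` is `Gal`-stable).  Then `(κ, Λ^θ, θ•z, x)`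
satisfies `ZetaBody`: SAME `κ`, SAME values `x`.  With `refit_bottom` / `smul_refit_levelFunctional_of_eigen`:
the bottom class is `(1 + c₀)•z_ℚ` while on a `χ`-eigenclass of `σ̃` the functional is rescaled by
`(χ(σ̃) + c₀)⁻¹` — the symmetry the twist-pin of memo v10 §3 does not see (memo v11 F6).
[cite: Kato2004Asterisque, (8.1.3) (p. 180), §9.4 (p. 188), Thm. 9.7 (p. 189), Thm. 6.6 (1) (p. 163)]
[cite: Rubin2000, Def. 2.1.1 and PCMI §4.1] -/
theorem zetaBody_refit
    (hc : ∀ (k : ℕ) (r : Finset (HeightOneSpectrum (𝓞 ℚ))),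
      (1 : ℚ_[p]) - ((-c₀ : ℤ_[p]) : ℚ_[p]) ^ (cycSubgroup p k r).index ≠ 0)
    (h : ZetaBody W p f ι κ Λ c d a A z x)
    (hES : IsEulerSystem (cyclotomicLevelsRat p (badPlaces c d A N)) (tateRep W p) p z')
    (hur : ∀ (k : ℕ) (r : (cyclotomicLevelsRat p (badPlaces c d A N)).Ideals)
      (v : HeightOneSpectrum (𝓞 ℚ)), ((primesEquiv v : Nat.Primes) : ℕ) ≠ p →
      ∀ 𝔓 ∈ v.primesAbove,
        resLe (tateRep W p).toTopRep
            (inf_le_left : (cyclotomicLevelsRat p (badPlaces c d A N)).level k r.1 ⊓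
              𝔓.inertia (absoluteGaloisGroup ℚ) ≤ (cyclotomicLevelsRat p (badPlaces c d A N)).level k r.1)
            1 (z' k r) = 0)
    (hloc : ∀ (k : ℕ) (r : Finset (HeightOneSpectrum (𝓞 ℚ))) (τ : absoluteGaloisGroup ℚ)
      (y : H1 (tateRep W p) (cycSubgroup p k r)),
      (∀ v : HeightOneSpectrum (𝓞 ℚ), ((primesEquiv v : Nat.Primes) : ℕ) = p →
        ∀ 𝔓 ∈ v.primesAbove,
          resLe (tateRep W p).toTopRep
              (inf_le_left : cycSubgroup p k r ⊓ MulAction.stabilizer (absoluteGaloisGroup ℚ) 𝔓 ≤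
                cycSubgroup p k r) 1 y = 0) →
      (∀ v : HeightOneSpectrum (𝓞 ℚ), ((primesEquiv v : Nat.Primes) : ℕ) = p →
        ∀ 𝔓 ∈ v.primesAbove,
          resLe (tateRep W p).toTopRep
              (inf_le_left : cycSubgroup p k r ⊓ MulAction.stabilizer (absoluteGaloisGroup ℚ) 𝔓 ≤
                cycSubgroup p k r) 1 (conjMap (tateRep W p).toTopRep (cycSubgroup p k r) τ 1 y) = 0)) :
    ZetaBody W p f ι κ Λ' c d a A z' x := by
  obtain ⟨-, -, h3a, h3b, h4, h5⟩ := h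
  refine ⟨hES, hur, ?_, ?_, ?_, h5⟩
  · -- (C3a): equivariance transported (`Gal(ℚ(μ_m)/ℚ)` abelian)
    intro k r τ y
    have hcomm := (cyclotomicLevelsRat p (∅ : Set (HeightOneSpectrum (𝓞 ℚ)))).commutator_le_level k r
    exact refit_functional_conj (cycSubgroup p k r) (hΛ' k r) hcomm τ
      (Algebra.TensorProduct.map (AlgHom.id ℚ ℚ_[p])
        (sigma (cycLevel p k r) (modNCyclotomicCharacter ℚ (cycLevel p k r) τ) :
          CyclotomicField (cycLevel p k r) ℚ →ₐ[ℚ] CyclotomicField (cycLevel p k r) ℚ)).toAddMonoidHom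
      (fun t v ↦ ZetaBodyScaling.map_id_smul _ t v) (fun y' ↦ h3a k r τ y') y
  · -- (C3b): locality transported
    intro k r y hy
    exact refit_functional_eq_zero_of (cycSubgroup p k r) (hΛ' k r) _ (hloc k r) (h3b k r) hy
  · -- (C4): `Λ^θ(θ•z) = Λ(z) = 1 ⊗ x`
    intro k r
    rw [hz' k r]
    exact (refit_functional_refit (cycSubgroup p k r.1) (hΛ' k r.1)
      (Subgroup.pow_index_mem (cycSubgroup p k r.1) σ) (hc k r.1) (z k r)).trans (h4 k r)

omit [Module.Free ℤ_[p] (W.tateModule p)] [Module.Finite ℤ_[p] (W.tateModule p)] hΛ' in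
/-- **At the bottom level the refit is the scalar `1 + c₀`:** `(θ•z)_ℚ = (1 + c₀) • z_ℚ`
(`Gal(ℚ̄/ℚ(μ_1)) = Γ_ℚ ∋ σ̃`).  So the `p`-divisibility position of the bottom class in
`H¹_f(ℚ, T_pW)/tors` moves by `v_p(1 + c₀)` — by `1` for `c₀ = p − 1`.
[cite: Serre1979, VII §5 Prop. 3] [cite: BurnsKuriharaSano2019, Hyp. 2.2 and (h1) (p. 9)] -/
theorem refit_bottom :
    z' 0 (cyclotomicLevelsRat p (badPlaces c d A N)).idealOne =
      (1 + c₀) • z 0 (cyclotomicLevelsRat p (badPlaces c d A N)).idealOne := by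
  rw [hz']
  exact refit_eq_smul_of_mem _
    ((cyclotomicLevelsRat p (∅ : Set (HeightOneSpectrum (𝓞 ℚ)))).top_le_level_bot_empty
      (Subgroup.mem_top σ)) c₀ _

omit [Module.Free ℤ_[p] (W.tateModule p)] [Module.Finite ℤ_[p] (W.tateModule p)] hz' in
/-- **On an eigenclass of `σ̃` at level `(k, r)` the refit functional is `(ε + c₀)⁻¹ • Λ_{k,r}`:**
`(ε + c₀) • Λ^θ_{k,r}(y) = Λ_{k,r}(y)` whenever `σ̃•y = ε•y` (granted `(−c₀)^{n_{k,r}} ≠ 1`).  For a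
`χ`-isotypic class (`ε = χ(σ̃)`) every clause of a single-component pin — kernel, image lattice with an
EXISTENTIAL exponent `a`, value — holds for `Λ^θ` with `a ↦ a − v_p(χ(σ̃) + c₀)`; with `refit_bottom`
the combination `pos(z_ℚ) − v_p(t_χ) + a` of memo v10 §3 moves by `v_p(1 + c₀) − v_p(χ(σ̃) + c₀)`,
`= 1 − 0` for `c₀ = p − 1`, `χ(σ̃) = −1`, `p` odd. [cite: Rubin2000, Ch. II §4]
[cite: BurnsKuriharaSano2019, Hyp. 2.2 and Remark 2.3 (p. 9)] -/
theorem smul_refit_levelFunctional_of_eigen (k : ℕ) (r : Finset (HeightOneSpectrum (𝓞 ℚ)))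
    (hc : (1 : ℚ_[p]) - ((-c₀ : ℤ_[p]) : ℚ_[p]) ^ (cycSubgroup p k r).index ≠ 0)
    {y : H1 (tateRep W p) (cycSubgroup p k r)} {ε : ℤ_[p]}
    (hy : conjMap (tateRep W p).toTopRep (cycSubgroup p k r) σ 1 y = ε • y) :
    (ε + c₀) • Λ' k r y = Λ k r y :=
  smul_refit_functional_of_eigen _ (hΛ' k r) (Subgroup.pow_index_mem _ σ) hc hy

omit hz' hΛ' in
/-- The admissible constant `c₀ = p − 1`: `(−c₀)^n = (1 − p)^n ≠ 1` in `ℚ_p` for `n ≠ 0` and `p ≥ 3`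
(so `zetaBody_refit` applies at every level, the levels having finite index, `index_cycSubgroup_ne_zero`),
while `1 + c₀ = p` and `−1 + c₀ = p − 2 ∈ ℤ_p^×`. [folklore] -/
theorem one_sub_neg_pow_ne_zero (hp : 3 ≤ p) {n : ℕ} (hn : n ≠ 0) :
    (1 : ℚ_[p]) - ((-((p : ℤ_[p]) - 1) : ℤ_[p]) : ℚ_[p]) ^ n ≠ 0 := by
  have hcast : ((-((p : ℤ_[p]) - 1) : ℤ_[p]) : ℚ_[p]) = ((1 - (p : ℤ) : ℤ) : ℚ_[p]) := by
    push_cast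
    ring
  rw [hcast, ← Int.cast_pow, ← Int.cast_one, ← Int.cast_sub, Int.cast_ne_zero, sub_ne_zero]
  intro h
  have habs : ((1 - (p : ℤ)) ^ n).natAbs = 1 := by rw [← h]; rfl
  rw [Int.natAbs_pow, Nat.pow_eq_one] at habs
  rcases habs with h1 | h0
  · have : ((1 - (p : ℤ))).natAbs = p - 1 := by omega
    omega
  · exact hn h0

omit hz' hΛ' in
/-- The index of a cyclotomic level is non-zero (open of finite index). [folklore] -/
theorem index_cycSubgroup_ne_zero (k : ℕ) (r : Finset (HeightOneSpectrum (𝓞 ℚ))) :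
    (cycSubgroup p k r).index ≠ 0 :=
  Subgroup.FiniteIndex.index_ne_zero

end ZetaBodyRefit

end Summit.BirchSwinnertonDyer.BirchSwinnertonDyer.Theorems.ZetaBodyRefit

end
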